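import Summits.KontsevichZagierPeriods.KontsevichZagierPeriods.Theorems.FermatIsogenyDeepWordSectorP08
/-! # `FermatIsogenyDeepWordSectorP09` — part 9/11 of the mechanical ≤400-line split of `DeepWordSector.lean` (sha256 5e8cd5c1c920648a…)
Source: decomp-kz lens-5 g22 DeepWordSector.lean v10 @5e8cd5c1 (the deep Beta-word sector node: bridge S ⟺ BetaWordTower ∧ WordSectorComplete, finite boxes, box ladder, shadow arithmetic, Chudnovsky levels; critic CLEARED g6-2/3/4/11/13/16/19); --supports stmt-KontsevichZagierPeriods-3898.
Split by census-1 g10 `gen/splitlean.py`: scopes re-opened with their `open`/`variable`/`set_option` context; mathematics and declaration order unchanged. -/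

namespace Summit.KontsevichZagierPeriods.FermatIsogeny.DeepTargets
open Literature.NumberTheory.Transcendental MeasureTheory
open Summit.KontsevichZagierPeriods.KontsevichZagierPeriods.Theses.FermatIsogeny (BetaLinearSector BetaProductSector FermatSectorComplete)

open Literature.NumberTheory.Transcendental MeasureTheory in
open Summit.KontsevichZagierPeriods.KontsevichZagierPeriods.Theses.FermatIsogeny (BetaLinearSector BetaProductSector FermatSectorComplete) in
/-- Rational numbers are real algebraic. [bookkeeping] -/
private theorem isAlgebraic_ratCast (x : ℚ) : IsAlgebraic ℚ (x : ℝ) := by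
  have h := isAlgebraic_algebraMap (R := ℚ) (A := ℝ) x
  rwa [eq_ratCast] at h

section ShadowArithmetic

/-- `Γ` on residues: `Γ((i mod N)/N)`, and `1` at the multiples of `N` (the integer arguments). [this node] -/
noncomputable def gg (N i : ℕ) : ℝ := if i % N = 0 then 1 else Real.Gamma (((i % N : ℕ) : ℝ) / N)

/-- Auxiliary step `gamma_div_pos`: gamma div pos. [bookkeeping] -/
theorem gamma_div_pos {N : ℕ} (hN : 0 < N) {m : ℕ} (hm : 0 < m) : 0 < Real.Gamma ((m : ℝ) / N) :=
  Real.Gamma_pos_of_pos (div_pos (by exact_mod_cast hm) (by exact_mod_cast hN))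

/-- Auxiliary step `gg_pos`: gg pos. [bookkeeping] -/
theorem gg_pos {N : ℕ} (hN : 0 < N) (i : ℕ) : 0 < gg N i := by
  unfold gg
  split_ifs with h
  · exact one_pos
  · exact gamma_div_pos hN (Nat.pos_of_ne_zero h)

/-- `Γ(i/N)` is a positive rational multiple of `gg N i` for `1 ≤ i ≤ 2N` (`Γ(1) = Γ(2) = 1`,
`Γ(1 + m/N) = (m/N)·Γ(m/N)`). [bookkeeping] -/
theorem gamma_eq_rat_mul_gg {N : ℕ} (hN : 0 < N) {i : ℕ} (h1 : 1 ≤ i) (h2 : i ≤ 2 * N) :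
    ∃ ρ : ℚ, 0 < ρ ∧ Real.Gamma ((i : ℝ) / N) = (ρ : ℝ) * gg N i := by
  have hNR : (0:ℝ) < N := by exact_mod_cast hN
  have hN0 : (N:ℝ) ≠ 0 := hNR.ne'
  rcases lt_trichotomy i N with hlt | heq | hgt
  · refine ⟨1, one_pos, ?_⟩
    have hmod : i % N = i := Nat.mod_eq_of_lt hlt
    have hne : i % N ≠ 0 := by rw [hmod]; omega
    simp only [gg, hne, if_false]
    rw [hmod]
    simp
  · refine ⟨1, one_pos, ?_⟩
    have hmod : i % N = 0 := by rw [heq]; exact Nat.mod_self N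
    simp only [gg, hmod, if_true]
    rw [heq, div_self hN0, Real.Gamma_one]
    simp
  · rcases eq_or_lt_of_le h2 with h2e | h2l
    · refine ⟨1, one_pos, ?_⟩
      have hmod : i % N = 0 := by rw [h2e]; simp
      have htwo : ((i:ℕ):ℝ) / N = 2 := by rw [h2e]; push_cast; field_simp
      simp only [gg, hmod, if_true]
      rw [htwo, Real.Gamma_two]
      simp
    · have hiN : i - N < N := by omega
      have hpos : 0 < i - N := by omega
      have hmod : i % N = i - N := by rw [Nat.mod_eq_sub_mod hgt.le, Nat.mod_eq_of_lt hiN]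
      have hne : i % N ≠ 0 := by omega
      refine ⟨((i - N : ℕ) : ℚ) / N, div_pos (by exact_mod_cast hpos) (by exact_mod_cast hN), ?_⟩
      have hs : ((i:ℕ):ℝ) / N = ((i - N : ℕ) : ℝ) / N + 1 := by
        rw [Nat.cast_sub hgt.le]; field_simp; ring
      have hs0 : ((i - N : ℕ) : ℝ) / N ≠ 0 := (div_pos (by exact_mod_cast hpos) hNR).ne'
      rw [hs, Real.Gamma_add_one hs0]
      simp only [gg, hne, if_false]
      rw [hmod]
      push_cast
      ring

/-- `Π_{0<m<N} Γ(m/N)^{[j ≡ m]} = gg N j`. [bookkeeping] -/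
theorem prod_gamma_zpow_ite {N : ℕ} (hN : 0 < N) (j : ℕ) :
    (∏ m ∈ Finset.Ico 1 N, Real.Gamma ((m : ℝ) / N) ^ (if j % N = m then (1:ℤ) else 0)) = gg N j := by
  have h : ∀ m ∈ Finset.Ico 1 N, Real.Gamma ((m : ℝ) / N) ^ (if j % N = m then (1:ℤ) else 0)
      = if j % N = m then Real.Gamma ((m : ℝ) / N) else 1 := by
    intro m _
    split_ifs <;> simp
  rw [Finset.prod_congr rfl h, Finset.prod_ite_eq]
  by_cases h0 : j % N = 0
  · rw [h0]
    have hnm : (0:ℕ) ∉ Finset.Ico 1 N := by simp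
    rw [if_neg hnm]
    simp [gg, h0]
  · have hmem : j % N ∈ Finset.Ico 1 N :=
      Finset.mem_Ico.mpr ⟨Nat.one_le_iff_ne_zero.mpr h0, Nat.mod_lt _ hN⟩
    simp only [hmem, if_true, gg, h0, if_false]

/-- The Γ-monomial of ONE letter: `Π_m Γ(m/N)^{letterMult} = gg(x+1)·gg(y+1)/gg(x+y+2)`. [bookkeeping] -/
theorem prod_gamma_zpow_letterMult {N : ℕ} (hN : 0 < N) (x y : Fin N) :
    (∏ m ∈ Finset.Ico 1 N, Real.Gamma ((m : ℝ) / N) ^ letterMult N x y m)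
      = gg N ((x:ℕ) + 1) * gg N ((y:ℕ) + 1) / gg N ((x:ℕ) + (y:ℕ) + 2) := by
  have hG : ∀ m ∈ Finset.Ico 1 N, Real.Gamma ((m : ℝ) / N) ≠ 0 := fun m hm =>
    (gamma_div_pos hN (Finset.mem_Ico.mp hm).1).ne'
  have h : ∀ m ∈ Finset.Ico 1 N, Real.Gamma ((m : ℝ) / N) ^ letterMult N x y m =
      Real.Gamma ((m : ℝ) / N) ^ (if ((x:ℕ) + 1) % N = m then (1:ℤ) else 0) *
      Real.Gamma ((m : ℝ) / N) ^ (if ((y:ℕ) + 1) % N = m then (1:ℤ) else 0) /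
      Real.Gamma ((m : ℝ) / N) ^ (if ((x:ℕ) + (y:ℕ) + 2) % N = m then (1:ℤ) else 0) := by
    intro m hm
    rw [letterMult, zpow_sub₀ (hG m hm), zpow_add₀ (hG m hm)]
  rw [Finset.prod_congr rfl h, Finset.prod_div_distrib, Finset.prod_mul_distrib,
    prod_gamma_zpow_ite hN, prod_gamma_zpow_ite hN, prod_gamma_zpow_ite hN]

/-- A letter value `B((x+1)/N,(y+1)/N)` is a positive rational times its Γ-monomial. [bookkeeping] -/
theorem bval_lvl_eq_rat_mul_monomial {k N : ℕ} (hN : 0 < N) (u v : Fin k → Fin N) (i : Fin k) :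
    ∃ ρ : ℚ, 0 < ρ ∧ bval (lvl N u i) (lvl N v i)
      = (ρ : ℝ) * ∏ m ∈ Finset.Ico 1 N, Real.Gamma ((m : ℝ) / N) ^ letterMult N (u i) (v i) m := by
  have hb := lvl_bounds hN u i
  have hb' := lvl_bounds hN v i
  rw [bval_eq hb.1 hb'.1, prod_gamma_zpow_letterMult hN]
  have hx : (u i : ℕ) < N := (u i).isLt
  have hy : (v i : ℕ) < N := (v i).isLt
  obtain ⟨ρ₁, hρ₁, e₁⟩ := gamma_eq_rat_mul_gg hN (i := (u i : ℕ) + 1) (by omega) (by omega)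
  obtain ⟨ρ₂, hρ₂, e₂⟩ := gamma_eq_rat_mul_gg hN (i := (v i : ℕ) + 1) (by omega) (by omega)
  obtain ⟨ρ₃, hρ₃, e₃⟩ := gamma_eq_rat_mul_gg hN (i := (u i : ℕ) + (v i : ℕ) + 2) (by omega) (by omega)
  have c₃ : ((lvl N u i : ℚ) : ℝ) + ((lvl N v i : ℚ) : ℝ) = (((u i : ℕ) + (v i : ℕ) + 2 : ℕ) : ℝ) / N := by
    simp only [lvl]; push_cast; ring
  have c₁ : ((lvl N u i : ℚ) : ℝ) = (((u i : ℕ) + 1 : ℕ) : ℝ) / N := by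
    simp only [lvl]; push_cast; ring
  have c₂ : ((lvl N v i : ℚ) : ℝ) = (((v i : ℕ) + 1 : ℕ) : ℝ) / N := by
    simp only [lvl]; push_cast; ring
  rw [c₃, c₁, c₂, e₁, e₂, e₃]
  refine ⟨ρ₁ * ρ₂ / ρ₃, by positivity, ?_⟩
  have g₃ : gg N ((u i : ℕ) + (v i : ℕ) + 2) ≠ 0 := (gg_pos hN _).ne'
  have r₃ : (ρ₃ : ℝ) ≠ 0 := by positivity
  push_cast
  field_simp

/-- `Π_{i∈s} a^{f i} = a^{Σ f i}` for `a ≠ 0`. [folklore] -/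
theorem prod_zpow_eq_zpow_sum {ι : Type*} (s : Finset ι) (a : ℝ) (ha : a ≠ 0) (f : ι → ℤ) :
    (∏ i ∈ s, a ^ f i) = a ^ (∑ i ∈ s, f i) := by
  classical
  refine Finset.induction_on s (by simp) ?_
  intro j s hj ih
  rw [Finset.prod_insert hj, Finset.sum_insert hj, ih, zpow_add₀ ha]

/-- A word value is a positive rational times its Γ-monomial. [bookkeeping] -/
theorem prod_bval_lvl_eq_rat_mul_monomial {k N : ℕ} (hN : 0 < N) (u v : Fin k → Fin N) :
    ∃ ρ : ℚ, 0 < ρ ∧ (∏ i, bval (lvl N u i) (lvl N v i))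
      = (ρ : ℝ) * ∏ m ∈ Finset.Ico 1 N, Real.Gamma ((m : ℝ) / N) ^ (∑ i, letterMult N (u i) (v i) m) := by
  choose ρ hρ he using fun i => bval_lvl_eq_rat_mul_monomial hN u v i
  refine ⟨∏ i, ρ i, Finset.prod_pos fun i _ => hρ i, ?_⟩
  rw [Finset.prod_congr rfl fun i _ => he i, Finset.prod_mul_distrib, Finset.prod_comm]
  push_cast
  congr 1
  refine Finset.prod_congr rfl fun m hm => ?_
  exact prod_zpow_eq_zpow_sum _ _ (gamma_div_pos hN (Finset.mem_Ico.mp hm).1).ne' _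

/-- **Word ratios are Γ-monomials**: `ratio(u,v;u',v') = ρ · Π_{0<m<N} Γ(m/N)^{pairMult m}`, `ρ ∈ ℚ_{>0}`. [this node] -/
theorem ratio_eq_rat_mul_monomial {k N : ℕ} (hN : 0 < N) (u v u' v' : Fin k → Fin N) :
    ∃ ρ : ℚ, 0 < ρ ∧ ratio u v u' v'
      = (ρ : ℝ) * ∏ m ∈ Finset.Ico 1 N, Real.Gamma ((m : ℝ) / N) ^ pairMult N u v u' v' m := by
  obtain ⟨ρ, hρ, e⟩ := prod_bval_lvl_eq_rat_mul_monomial hN u v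
  obtain ⟨ρ', hρ', e'⟩ := prod_bval_lvl_eq_rat_mul_monomial hN u' v'
  refine ⟨ρ / ρ', div_pos hρ hρ', ?_⟩
  unfold ratio
  rw [e, e', mul_div_mul_comm, ← Finset.prod_div_distrib]
  push_cast
  congr 1
  refine Finset.prod_congr rfl fun m hm => ?_
  rw [pairMult, zpow_sub₀ (gamma_div_pos hN (Finset.mem_Ico.mp hm).1).ne']

/-- Transfer `ℝ ↔ ℂ` of algebraicity over `ℚ`. [folklore] -/
theorem isAlgebraic_ofReal_iff {x : ℝ} : IsAlgebraic ℚ (x : ℂ) ↔ IsAlgebraic ℚ x := by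
  have h := isAlgebraic_algebraMap_iff (R := ℚ) (A := ℂ) (a := x) (RCLike.ofReal_injective (K := ℂ))
  rw [Complex.coe_algebraMap] at h
  exact h

/-- **Koblitz–Ogus / Deligne in real form**: a Γ-monomial of DKO type `0` is (real) algebraic — the tree theorem
`deligne_gammaMonomial_algebraic_holds` with `c = 0`, transferred to `ℝ`. (cite Deligne1982HodgeCycles, Thm. 7.18 (a)) -/
theorem isAlgebraic_monomial_of_hodgeType_zero {N : ℕ} (hN : 1 < N) {n : ℕ → ℤ}
    (hT : IsHodgeTypeGammaMonomial N n 0) :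
    IsAlgebraic ℚ (∏ m ∈ Finset.Ico 1 N, Real.Gamma ((m : ℝ) / N) ^ n m) := by
  have hKO := deligne_gammaMonomial_algebraic_holds N n 0 hN hT
  unfold gammaTilde at hKO
  rw [neg_zero, zpow_zero, one_mul] at hKO
  have hc : (∏ i ∈ Finset.Ico 1 N, ((Real.Gamma ((i : ℝ) / N) : ℂ)) ^ n i)
      = (((∏ m ∈ Finset.Ico 1 N, Real.Gamma ((m : ℝ) / N) ^ n m : ℝ)) : ℂ) := by
    push_cast; rfl
  rw [hc] at hKO
  exact isAlgebraic_ofReal_iff.mp hKO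

/-- `i` is algebraic (root of `X² + 1`). [folklore] -/
private theorem isAlgebraic_I : IsAlgebraic ℚ Complex.I := by
  refine ⟨Polynomial.X ^ 2 + Polynomial.C 1, Polynomial.X_pow_add_C_ne_zero (by norm_num) 1, ?_⟩
  simp [Complex.I_sq]

/-- **The constant-type shadow, PROVED** (Deligne + Lindemann, both tree theorems): a Γ-monomial of constant DKO type
`c ≠ 0` is transcendental — it is `ℚ̄ˣ·(2πi)^c`, and `(2πi)^c ∈ ℚ̄` would make `π` algebraic. [this node] -/
theorem transcendental_monomial_of_constType {N : ℕ} (hN : 1 < N) {n : ℕ → ℤ} {c : ℤ} (hc : c ≠ 0)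
    (hT : IsHodgeTypeGammaMonomial N n c) :
    Transcendental ℚ (∏ m ∈ Finset.Ico 1 N, Real.Gamma ((m : ℝ) / N) ^ n m) := by
  intro hA
  have hN0 : 0 < N := by omega
  set A : ℝ := ∏ m ∈ Finset.Ico 1 N, Real.Gamma ((m : ℝ) / N) ^ n m with hAdef
  have hA0 : A ≠ 0 := Finset.prod_ne_zero_iff.mpr fun m hm =>
    zpow_ne_zero _ (gamma_div_pos hN0 (Finset.mem_Ico.mp hm).1).ne'
  have hKO := deligne_gammaMonomial_algebraic_holds N n c hN hT
  unfold gammaTilde at hKO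
  have hc' : (∏ i ∈ Finset.Ico 1 N, ((Real.Gamma ((i : ℝ) / N) : ℂ)) ^ n i) = ((A : ℝ) : ℂ) := by
    rw [hAdef]; push_cast; rfl
  rw [hc'] at hKO
  have hAC : IsAlgebraic ℚ ((A : ℝ) : ℂ) := isAlgebraic_ofReal_iff.mpr hA
  have hAC0 : ((A : ℝ) : ℂ) ≠ 0 := Complex.ofReal_ne_zero.mpr hA0
  set z : ℂ := 2 * (Real.pi : ℂ) * Complex.I with hzdef
  have hz : IsAlgebraic ℚ (z ^ (-c)) := by
    have h2 := hKO.mul hAC.inv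
    rwa [mul_assoc, mul_inv_cancel₀ hAC0, mul_one] at h2
  have hzn : IsAlgebraic ℚ (z ^ c.natAbs) := by
    rcases Int.natAbs_eq c with h | h
    · have h3 := hz.inv
      rw [← zpow_neg, neg_neg, h, zpow_natCast] at h3
      exact h3
    · rw [h, neg_neg, zpow_natCast] at hz
      exact hz
  have hz1 : IsAlgebraic ℚ z := IsAlgebraic.of_pow (Int.natAbs_pos.mpr hc) hzn
  have h2 : IsAlgebraic ℚ (2 : ℂ) := by simpa using isAlgebraic_nat (R := ℚ) (A := ℂ) 2
  have h2I : IsAlgebraic ℚ (2 * Complex.I) := h2.mul isAlgebraic_I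
  have h2I0 : (2 * Complex.I : ℂ) ≠ 0 := mul_ne_zero two_ne_zero Complex.I_ne_zero
  have hpiC : IsAlgebraic ℚ ((Real.pi : ℝ) : ℂ) := by
    have h4 := hz1.mul h2I.inv
    have e : z * (2 * Complex.I)⁻¹ = (Real.pi : ℂ) := by
      rw [hzdef]; field_simp
    rwa [e] at h4
  exact transcendental_pi_holds (isAlgebraic_ofReal_iff.mp hpiC)

/-- The patterns NOT of non-zero constant DKO type — the complement of the Lindemann part of a box. [this node] -/
def NotConstType {k : ℕ} (N : ℕ) : PatternPred k N := fun u v u' v' =>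
  ¬ ∃ c : ℤ, c ≠ 0 ∧ IsHodgeTypeGammaMonomial N (pairMult N u v u' v') c

/-- **Constant non-zero type ⇒ transcendental value ratio**, at every level (Deligne + Lindemann). [this node] -/
theorem transcendental_ratio_of_constType {k N : ℕ} (hN : 1 < N) (u v u' v' : Fin k → Fin N) {c : ℤ}
    (hc : c ≠ 0) (hT : IsHodgeTypeGammaMonomial N (pairMult N u v u' v') c) :
    Transcendental ℚ (ratio u v u' v') := by
  intro halg
  obtain ⟨ρ, hρ, e⟩ := ratio_eq_rat_mul_monomial (by omega) u v u' v'
  have hρ0 : (ρ : ℝ) ≠ 0 := by exact_mod_cast hρ.ne'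
  apply transcendental_monomial_of_constType hN hc hT
  have h2 := (isAlgebraic_ratCast ρ⁻¹).mul halg
  rw [e, ← mul_assoc] at h2
  simpa [hρ0] using h2

/-- **The Lindemann part of every box holds** (`1 < N`): `BoxTranscendence k N (NotConstType N)`. [this node] -/
theorem boxTranscendence_notConstType (k : ℕ) {N : ℕ} (hN : 1 < N) : BoxTranscendence k N (NotConstType N) := by
  intro u v u' v' h
  simp only [NotConstType, not_not] at h
  obtain ⟨c, hc, hT⟩ := h
  exact transcendental_ratio_of_constType hN u v u' v' hc hT

/-- **Every finite box minus its Lindemann part, unconditionally**: `BetaWordSectorLevel k N ↔ BoxChain k N (NotConstType N)`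
for `1 < N` — the box restricted to the patterns whose Γ-monomial is not of non-zero constant type. [this node] -/
theorem box_iff_boxChain_notConstType (k : ℕ) {N : ℕ} (hN : 1 < N) :
    BetaWordSectorLevel k N ↔ BoxChain k N (NotConstType N) :=
  box_iff_boxChain (by omega) (boxTranscendence_notConstType k hN)

/-- **Koblitz–Ogus direction for words**: same DKO type ⇒ the value ratio is algebraic (so the chain side's value
hypothesis is satisfiable with `q := ratio`). [this node] -/
theorem isAlgebraic_ratio_of_sameType {k N : ℕ} (hN : 0 < N) (u v u' v' : Fin k → Fin N)
    (h : SameType N u v u' v') : IsAlgebraic ℚ (ratio u v u' v') := by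
  obtain ⟨ρ, hρ, e⟩ := ratio_eq_rat_mul_monomial hN u v u' v'
  rw [e]
  refine (isAlgebraic_ratCast ρ).mul ?_
  rcases Nat.lt_or_ge 1 N with h1 | h1
  · exact isAlgebraic_monomial_of_hodgeType_zero h1 h
  · have hN1 : N = 1 := by omega
    subst hN1
    rw [show Finset.Ico 1 1 = ∅ from Finset.Ico_self 1, Finset.prod_empty]
    exact isAlgebraic_one

/-- **Rohrlich's conjecture, Hodge-type form** (the `ℚ`-tensored content of [Waldschmidt 2006, Conjecture 21] for
monomials in `Γ(m/N)`): an ALGEBRAIC Γ-monomial `Π_{0<m<N} Γ(m/N)^{n m}` has Deligne–Koblitz–Ogus type identically `0`.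
(Conj. 21 makes such a relation a consequence of the standard relations; every standard relation has constant type
equal to its `π`-exponent, and an algebraic monomial carries no `π`.)  OPEN — a conjecture, used only as a hypothesis.
The converse is Deligne's theorem (`isAlgebraic_monomial_of_hodgeType_zero`). [conjecture; cite: Waldschmidt 2006, Conj. 21] -/
def RohrlichHodge : Prop :=
  ∀ (N : ℕ) (n : ℕ → ℤ), 1 < N →
    IsAlgebraic ℚ (∏ m ∈ Finset.Ico 1 N, Real.Gamma ((m : ℝ) / N) ^ n m) → IsHodgeTypeGammaMonomial N n 0

/-- **The whole Rohrlich shadow from ONE Γ-conjecture**: `RohrlichHodge → RohrlichLangShadow k` for every `k`. [this node] -/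
theorem rohrlichLangShadow_of_rohrlichHodge (hR : RohrlichHodge) (k : ℕ) : RohrlichLangShadow k := by
  intro N hN u v u' v' hns halg
  apply hns
  rcases Nat.lt_or_ge 1 N with h1 | h1
  · obtain ⟨ρ, hρ, e⟩ := ratio_eq_rat_mul_monomial hN u v u' v'
    have hρ0 : (ρ : ℝ) ≠ 0 := by exact_mod_cast hρ.ne'
    refine hR N _ h1 ?_
    have h2 := (isAlgebraic_ratCast ρ⁻¹).mul halg
    rw [e, ← mul_assoc] at h2
    simpa [hρ0] using h2
  · have hN1 : N = 1 := by omega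
    subst hN1
    intro w _
    simp

/-- Under `RohrlichHodge`, every `k`-letter sector is exactly its same-type chains, level by level. [this node] -/
theorem betaWordSector_iff_sameTypeChains_of_rohrlichHodge (hR : RohrlichHodge) (k : ℕ) :
    BetaWordSector k ↔ ∀ N, 0 < N → BoxChain k N (SameType N) :=
  betaWordSector_iff_sameTypeChains (rohrlichLangShadow_of_rohrlichHodge hR k)

/-- Under `RohrlichHodge`: `BetaProductSector` (3898) ↔ same-type two-letter chains at every level. [this node] -/
theorem betaProductSector_iff_sameTypeChains_of_rohrlichHodge (hR : RohrlichHodge) :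
    BetaProductSector ↔ ∀ N, 0 < N → BoxChain 2 N (SameType N) :=
  betaProductSector_iff_sameTypeChains (rohrlichLangShadow_of_rohrlichHodge hR 2)

end ShadowArithmetic

/-! ## v9 (lens-5 g22 · addendum 2) — THE SHADOW LEVEL BY LEVEL: φ(N) ≤ 2 IS DECIDED MODULO CHUDNOVSKY

`RohrlichHodgeAt N` := «an algebraic Γ-monomial on `Γ(m/N)`, `0<m<N`, has DKO type ≡ 0» — the level-`N` slice of
`RohrlichHodge` (`rohrlichHodge_iff_forall`); it gives the same-type shadow of EVERY box at level `N`
(`boxTranscendence_sameType_of_rohrlichHodgeAt`) and hence `BetaWordSectorLevel k N ↔ BoxChain k N (SameType N)`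
(`betaWordSectorLevel_iff_of_rohrlichHodgeAt`).  Level by level:
* `N = 2`: PROVED (`rohrlichHodgeAt_two`, Lindemann: the monomial is `(√π)^{n₁}`);
* `N = 3, 4, 6` (the levels with `φ(N) = 2`): every Γ-monomial is `ℚ̄ˣ·Γ(⅓)^A·(√π)^B` resp. `ℚ̄ˣ·Γ(¼)^A·(√π)^B`
  (reflection, `Γ(½) = √π`, Legendre duplication at `⅙`), and the type vanishes iff `(A,B) = 0`; so `RohrlichHodgeAt N`
  follows from the multiplicative independence of `Γ(⅓), π` resp. `Γ(¼), π` modulo `ℚ̄ˣ` — consequences of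
  Chudnovsky's 1976 theorem [Waldschmidt 2006, Thm. 14], typed as hypotheses `GammaThirdPiIndep`, `GammaQuarterPiIndep`
  (never facts): `rohrlichHodgeAt_three_of`, `rohrlichHodgeAt_four_of`, `rohrlichHodgeAt_six_of`;
* `N = 5` and `φ(N) ≥ 4`: OPEN (NODE §D: at `N = 5` it is the multiplicative independence of `Γ(⅕), Γ(⅖), π`).
Corollaries: `betaWordSectorLevel_three_iff`, `_four_iff`, `_six_iff` — the level-3/4/6 boxes of every `k`-letter
sector (in particular of 3898) are exactly their same-type chains, modulo Chudnovsky.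
-/

section ChudnovskyLevels

/-- Integer powers of an algebraic real are algebraic. [folklore] -/
private theorem isAlgebraic_zpow {x : ℝ} (hx : IsAlgebraic ℚ x) (m : ℤ) : IsAlgebraic ℚ (x ^ m) := by
  cases m with
  | ofNat k => rw [Int.ofNat_eq_natCast, zpow_natCast]; exact hx.pow k
  | negSucc k => rw [zpow_negSucc]; exact (hx.pow _).inv

/-- `√n` is algebraic. [folklore] -/
theorem isAlgebraic_sqrt_nat (n : ℕ) : IsAlgebraic ℚ (Real.sqrt n) := by
  refine ⟨Polynomial.X ^ 2 - Polynomial.C (n:ℚ), Polynomial.X_pow_sub_C_ne_zero (by norm_num) _, ?_⟩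
  simp [Real.sq_sqrt (Nat.cast_nonneg n)]

/-- `(2^{2/3})³ = 4`. [folklore] -/
theorem two_rpow_two_thirds_pow_three : ((2:ℝ) ^ ((2:ℝ)/3)) ^ 3 = 4 := by
  rw [← Real.rpow_natCast, ← Real.rpow_mul (by norm_num : (0:ℝ) ≤ 2),
    show (2:ℝ)/3 * ((3:ℕ):ℝ) = ((2:ℕ):ℝ) by norm_num, Real.rpow_natCast]
  norm_num

/-- `2^{2/3}` is algebraic (root of `X³ − 4`). [folklore] -/
theorem isAlgebraic_two_rpow_two_thirds : IsAlgebraic ℚ ((2:ℝ) ^ ((2:ℝ)/3)) := by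
  refine ⟨Polynomial.X ^ 3 - Polynomial.C 4, Polynomial.X_pow_sub_C_ne_zero (by norm_num) _, ?_⟩
  simp [two_rpow_two_thirds_pow_three]

/-- Auxiliary step `prod_Ico_one_two`: prod Ico one two. [bookkeeping] -/
theorem prod_Ico_one_two (f : ℕ → ℝ) : ∏ m ∈ Finset.Ico 1 2, f m = f 1 := by
  rw [Finset.prod_Ico_eq_prod_range]; simp

/-- Auxiliary step `sum_Ico_one_two`: sum Ico one two. [bookkeeping] -/
theorem sum_Ico_one_two (f : ℕ → ℚ) : ∑ m ∈ Finset.Ico 1 2, f m = f 1 := by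
  rw [Finset.sum_Ico_eq_sum_range]; simp

/-- Auxiliary step `prod_Ico_one_three`: prod Ico one three. [bookkeeping] -/
theorem prod_Ico_one_three (f : ℕ → ℝ) : ∏ m ∈ Finset.Ico 1 3, f m = f 1 * f 2 := by
  rw [Finset.prod_Ico_eq_prod_range]; simp [Finset.prod_range_succ]

end ChudnovskyLevels
end Summit.KontsevichZagierPeriods.FermatIsogeny.DeepTargets
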